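import Literature.Computability.Complexity.CircuitClasses
import Literature.Computability.Complexity.CircuitClassesProofs
import Literature.Computability.Complexity.TM2Circuits
import HarnessLib

/-!
# `P ⊆ P/poly` (Arora–Barak 2009, Thm. 6.6) and `BPP ⊆ P/poly` (Thm. 7.14), discharged

Sibling proof file of `CircuitClasses.lean` (D-0014: named facts `def X : Prop` are discharged
as `theorem X_holds : X`; this file contains theorems only). It discharges

* `Literature.CplxCore.P_subset_PPoly_holds : P_subset_PPoly` — every language decidable in
  deterministic polynomial time is decided by a polynomial-size family of `B₂`-circuits
  (Arora–Barak 2009, Thm. 6.6, pp. 109–110), and, as its one-line consequence through the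
  relative form of Adleman's theorem `BPP_subset_PPoly_of_P_subset_PPoly` proved in
  `CircuitClassesProofs.lean`,
* `Literature.CplxCore.BPP_subset_PPoly_holds : BPP_subset_PPoly` (Adleman 1978; Arora–Barak 2009,
  Thm. 7.14).

Here `P` is deterministic polynomial time on Mathlib's multi-stack machines `Turing.FinTM2`
(`Classes.lean`, `TimeBounds.lean`) and `PPoly` is the union over polynomials `p` of `SIZE p`,
the languages decided by families of `B₂` straight-line circuits of size `≤ p n`
(`CircuitClasses.lean`, `Circuit.lean`).

## Proof architecture (Arora–Barak 2009, proof of Thm. 6.6, in the direct tableau form of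
Sipser 2012, Thm. 9.30, i.e. without the oblivious-machine preprocessing of Remark 1.7)

All the work is the machine-to-circuit simulation `FinTM2.exists_cktSize_sim` of
`TM2Circuits.lean` (padded configurations, cell-locality of one machine step, one-hot coding,
Shannon bound per output bit via `LocalMaps.lean`/`CircuitComposition.lean`): for a machine `tm`
there are constants `c₀, D` such that `T` steps on inputs of length `n` are computed, for every
capacity `S > n + D · T`, by a `B₂`-straight-line program of size `≤ c₀ (S + 1) (T + 1)` whose
output bit tells whether the top output symbol of the halting configuration is a designated
symbol. Given `L ∈ P`, i.e. a bundled machine `M : TM2ComputableAux Bool Bool` writing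
`[L.boolIndicator x]` within `T(n) = c nᵏ + c` steps, take `S(n) = n + D · T(n) + 1`; the
family obtained from `CktSize.toCircuit` has size `≤ c₀ (S(n) + 1) (T(n) + 1)`, which *is* a
polynomial in `n`, and decides `L` because the machine's output symbol is
`M.outputAlphabet.symm (L.boolIndicator x)`.

## References

* S. Arora, B. Barak, *Computational Complexity: A Modern Approach*, CUP 2009, Thm. 6.6
  (`P ⊆ P/poly`), pp. 109–110; Thm. 7.14 (`BPP ⊆ P/poly`), p. 136.
* M. Sipser, *Introduction to the Theory of Computation*, 3rd ed. (2012), Thm. 9.30, p. 338.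
* L. Adleman, *Two theorems on random polynomial time*, FOCS 1978.
-/

namespace Literature.Computability.Complexity

open Turing Polynomial

/-- **`P ⊆ P/poly`** (Arora–Barak 2009, Thm. 6.6): every language decidable in deterministic
polynomial time (on Mathlib's `FinTM2` machines) is decided by a polynomial-size family of
`B₂`-circuits. Discharge of the named fact `P_subset_PPoly`. [cite: AroraBarakCC2009, Thm. 6.6] -/
theorem P_subset_PPoly_holds : P_subset_PPoly := by
  intro L hL
  simp only [Classes.P, DTIME, TimeClass, Set.mem_iUnion, Set.mem_setOf_eq] at hL
  obtain ⟨k, c, M, hM⟩ := hL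
  -- the simulation constants of the machine
  obtain ⟨c₀, D, hsim⟩ := FinTM2.exists_cktSize_sim M.tm (fun b => M.inputAlphabet.symm b)
    (M.outputAlphabet.symm true)
  -- running time and capacity at input length `n`
  set T : ℕ → ℕ := fun n => c * n ^ k + c with hT
  set S : ℕ → ℕ := fun n => n + D * T n + 1 with hS
  choose F hF hspec using fun n => hsim n (T n) (S n) (by simp [hS])
  choose C hC using fun n => (hF n).toCircuit
  refine Set.mem_iUnion.2 ⟨Polynomial.C c₀ * (X + Polynomial.C D * (Polynomial.C c * X ^ k +
      Polynomial.C c) + 2) * (Polynomial.C c * X ^ k + Polynomial.C c + 1), C,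
    fun n => ⟨(hC n).1, (hC n).2.1.trans (le_of_eq ?_)⟩, fun x => ?_⟩
  · simp only [hS, hT, eval_mul, eval_add, eval_C, eval_X, eval_pow, eval_ofNat, eval_one]
    ring
  · rw [(hC x.length).2.2]
    -- the machine's run on `x`
    have hx : Nonempty (TM2OutputsInTime M.tm (List.ofFn fun i => M.inputAlphabet.symm (x.get i))
        (some [M.outputAlphabet.symm (L.boolIndicator x)]) (T x.length)) := by
      have e : x.map M.inputAlphabet.symm = List.ofFn fun i => M.inputAlphabet.symm (x.get i) := by
        conv_lhs => rw [← List.ofFn_get x]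
        rw [List.map_ofFn]
        rfl
      have hp : ∀ b : Bool, (pure b : List Bool) = [b] := fun _ => rfl
      have := hM x
      simp only [TM2ComputableAux.OutputsWithin, Computability.encodeBool, id, hp, List.map_cons,
        List.map_nil, e] at this
      exact this
    have key := hspec x.length x.get _ [] hx
    rw [Equiv.apply_eq_iff_eq] at key
    rw [Bool.eq_iff_iff, key]

/-- **`BPP ⊆ P/poly`** (Adleman 1978; Arora–Barak 2009, Thm. 7.14): discharge of the named fact
`BPP_subset_PPoly`, by feeding `P_subset_PPoly_holds` (Thm. 6.6) to the relative form
`BPP_subset_PPoly_of_P_subset_PPoly` (Adleman's argument: error reduction, union bound,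
hardwiring; `CircuitClassesProofs.lean`). [cite: AroraBarakCC2009, Thm. 7.14] -/
theorem BPP_subset_PPoly_holds : BPP_subset_PPoly :=
  BPP_subset_PPoly_of_P_subset_PPoly P_subset_PPoly_holds

end Literature.Computability.Complexity
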